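import Summits.HodgeConjecture.HodgeConjecture.Theorems.K2E5QuatLocalNormSurjective   -- ★ `exists_mul_gal_eq_of_inert` (Serre V §2: fixed units are norms at an inert unramified place; CM `adicCompletion` letters)
import Literature.NumberTheory.Rogawski1990.Ch3Sec10to13                               -- ★ `Ch3Sec10to13.IsNormFromE` («`x ∈ NE*`»)
import Mathlib.Algebra.Ring.NegOnePow
import HarnessLib

/-!
# R90 · S6 «Ch. 14.1–14.5 stable trace formula» — card K3: `ω_{E∕F} ∘ det` — THE PARITY DISCHARGE OF THE κ-BINDER
# (`Theorems/R90S6UnramifiedNormParity.lean`)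

Rows E1.3.5.2.2 ∕ E1.4.4.2.4 (dealer R90-C14-plan (g2), card K3 2026-09-05T01:12:24Z).  The printed `κ`'s of the twisted fundamental lemma are
`ω_{E∕F}(det(…))` ∕ `μ(det(δ^ν δ⁻¹))` ([Rogawski1990] §3.12, §4.11 p. 64), `ω_{E_w∕F_v}` the quadratic character of the unramified quadratic extension;
★ L2-sgn ∕ L4 (`Theorems/R90S6TwistedShellSign`, `Theorems/R90S6TwistedKappaOrbitalSign`, R90-C14-p04) carry `κ` as the explicit PARITY binder
`hκ : κ ν = (log_q‖det δ‖ − log_q‖det d_ν‖).negOnePow` (`WithZero.log ∘ Valued.v`, Mathlib `Int.negOnePow`).  This file closes the gap, in the same generic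
`Valued K ℤᵐ⁰` letters (`K = E_w`, `σ` the conjugation, `ϖ` a `σ`-fixed uniformizer — the inert unramified dictionary `ord_w|_{F_v} = ord_v`):

* §1 **`exists_eq_mul_map_iff_even_log`** — for `σ`-fixed `x ≠ 0`: `x ∈ N(E_w^×)` (`∃ w ≠ 0, x = w·σw`, i.e. ★ `Ch3Sec10to13.IsNormFromE`, §1′) **iff
  `ord_w x` is even**; (→) `v(w·σw) = v(w)²` (only `hvσ`); (←) `x·ϖ^{2k}` is a `σ`-fixed UNIT, hence a norm by the one arithmetic input «fixed units are norms»
  (binder `hunit`, = ★ `exists_mul_gal_eq_of_inert` at a CM place, §4), and `x = (sϖ^{−k})·σ(sϖ^{−k})`.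
* §2 **`ite_exists_eq_mul_map_eq_negOnePow_log`** — the unramified quadratic character AS A SIGN: `ω(x) := [x ∈ N(E^×)] ? 1 : −1 = (ord_w x).negOnePow`.
* §3 **`ite_isNorm_det_eq_negOnePow_log_sub`** — THE DISCHARGE: for `d, δ ∈ GL_N(E_w)` with `det(d·δ⁻¹) ∈ F_v` (binder `hfix`),
  `ω(det(d·δ⁻¹)) = (log v det δ − log v det d).negOnePow` — EXACTLY L4's `hκ`, so ★ `sum_negOnePow_mul_epsOrbitalIntegral_twistedShell` is instantiated from the
  printed `κ_ν = ω(det(d_ν δ⁻¹))`.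
* §4 **`exists_mul_galAdicCompletionMap_eq_of_valued_eq_one`** — the CM discharge of `hunit` at an inert unramified place (★ Serre V §2 in the tree).

Lane `--kind proof --supports stmt-HodgeConjecture-24833 --as helper`; THEOREMS ONLY (no definition — `ω` is written as an `if`; no instance, no notation,
no named fact, no `sorry`).  Seat R90-C14-p08 (g0).
HONEST LABEL: a local dictionary lemma, count-neutral until E1.3.5.2.2 ∕ E1.4.4.3.1 consume it; HC_CM is proved only modulo the 7 printed citations
(2 remaining named inputs: hLiu418 = stmt-HodgeConjecture-24832, h413 = stmt-HodgeConjecture-24833) until rung 0 closes.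

## References
* [Rogawski1990] J. D. Rogawski, *Automorphic Representations of Unitary Groups in Three Variables* (1990): §3.12 Prop. 3.12.1 (b) p. 37; §4.11 p. 64.
* [Serre1979] J.-P. Serre, *Local Fields* (1979): Ch. V §2 Prop. 3 and Corollary (the norm on units of an unramified extension is surjective).
* [Kottwitz1986BaseChangeUnits] R. E. Kottwitz, *Base change for unit elements of Hecke algebras*, Compositio Math. 60 (1986): §1 p. 243.
-/

set_option autoImplicit false
-- the mandated namespace repeats the single-problem summit's segment (`HodgeConjecture.HodgeConjecture`)
set_option linter.dupNamespace false

noncomputable section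

open scoped Valued WithZero Matrix MatrixGroups

namespace Summit.HodgeConjecture.HodgeConjecture.R90.S6

/-! ## §1 Norms ⟷ even valuation -/

section Norm

variable {K : Type*} [Field K] [Valued K ℤᵐ⁰] {σ : K →+* K}

/-- A norm `w·σw` (`w ≠ 0`) has EVEN valuation exponent: `log v (w·σw) = 2·log v w` (`σ` valuation-preserving). [cite: Rogawski1990, §3.12 p. 37] -/
theorem even_log_of_eq_mul_map (hvσ : ∀ a, Valued.v (σ a) = Valued.v a) {x w : K} (hw : w ≠ 0) (hx : x = w * σ w) :
    Even (WithZero.log (Valued.v x)) := by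
  have hvw : Valued.v w ≠ 0 := (Valuation.ne_zero_iff _).2 hw
  refine ⟨WithZero.log (Valued.v w), ?_⟩
  rw [hx, map_mul, hvσ, WithZero.log_mul hvw hvw]

/-- **K3 §1 — `x ∈ N(E_w^×) ⟺ ord_w x` EVEN** for a `σ`-fixed `x ≠ 0`, at an unramified place: `σ` valuation-preserving, `ϖ` a `σ`-fixed uniformizer
(`v ϖ = exp(−1)` — the inert dictionary `ord_w|_F = ord_v`), and the one arithmetic input «every `σ`-fixed unit is a norm» (`hunit`; ★ §4 at a CM place).
(←): `u := x·ϖ^{2k}` is a fixed unit, `u = s·σs`, and `x = (sϖ^{−k})·σ(sϖ^{−k})`. [cite: Serre1979, Ch. V §2 Cor.] [cite: Rogawski1990, §3.12 Prop. 3.12.1 (b)] -/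
theorem exists_eq_mul_map_iff_even_log (hvσ : ∀ a, Valued.v (σ a) = Valued.v a) {ϖ : K} (hϖ : Valued.v ϖ = WithZero.exp (-1 : ℤ))
    (hσϖ : σ ϖ = ϖ) (hunit : ∀ u : K, Valued.v u = 1 → σ u = u → ∃ s : K, s * σ s = u) {x : K} (hx : x ≠ 0) (hσx : σ x = x) :
    (∃ w : K, w ≠ 0 ∧ x = w * σ w) ↔ Even (WithZero.log (Valued.v x)) := by
  refine ⟨fun ⟨w, hw, hxw⟩ => even_log_of_eq_mul_map hvσ hw hxw, fun ⟨k, hk⟩ => ?_⟩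
  have hϖ0 : ϖ ≠ 0 := (Valuation.ne_zero_iff Valued.v).1 (by rw [hϖ]; exact WithZero.exp_ne_zero)
  have hvx : Valued.v x ≠ 0 := (Valuation.ne_zero_iff _).2 hx
  have hvϖz : ∀ n : ℤ, Valued.v (ϖ ^ n) = WithZero.exp (-n) := fun n => by
    rw [map_zpow₀, hϖ, ← WithZero.exp_zsmul, smul_eq_mul, mul_neg, mul_one]
  -- the `σ`-fixed unit `u = x · ϖ^{2k}`
  have hu1 : Valued.v (x * ϖ ^ (k + k)) = 1 := by
    rw [map_mul, hvϖz, ← WithZero.exp_log hvx, hk, ← WithZero.exp_add, add_neg_cancel, WithZero.exp_zero]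
  have hσu : σ (x * ϖ ^ (k + k)) = x * ϖ ^ (k + k) := by rw [map_mul, map_zpow₀, hσx, hσϖ]
  obtain ⟨s, hs⟩ := hunit _ hu1 hσu
  have hs0 : s ≠ 0 := by
    rintro rfl
    rw [zero_mul] at hs
    exact mul_ne_zero hx (zpow_ne_zero _ hϖ0) hs.symm
  refine ⟨s * ϖ ^ (-k), mul_ne_zero hs0 (zpow_ne_zero _ hϖ0), ?_⟩
  rw [map_mul, map_zpow₀, hσϖ]
  calc x = x * ϖ ^ (k + k) * ϖ ^ (-(k + k)) := by
          rw [mul_assoc, ← zpow_add₀ hϖ0, add_neg_cancel, zpow_zero, mul_one]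
    _ = s * σ s * (ϖ ^ (-k) * ϖ ^ (-k)) := by rw [hs, ← zpow_add₀ hϖ0, neg_add]
    _ = s * ϖ ^ (-k) * (σ s * ϖ ^ (-k)) := by ring

end Norm

/-! ## §1′ The same in the letters of ★ `Ch3Sec10to13.IsNormFromE` -/

section NormFromE

variable {F K : Type} [Field F] [Field K] [Algebra F K] [Valued K ℤᵐ⁰] (σ : K ≃ₐ[F] K)

/-- **`IsNormFromE F K σ x ⟺ ord x` even** (★ `Ch3Sec10to13.IsNormFromE` = «`x ∈ NE*`», `σ : K ≃ₐ[F] K`), same hypotheses as §1 (`Iff.rfl` junction).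
[cite: Rogawski1990, §3.12 Prop. 3.12.1 (b) p. 37] [cite: Serre1979, Ch. V §2 Cor.] -/
theorem isNormFromE_iff_even_log (hvσ : ∀ a, Valued.v (σ a) = Valued.v a) {ϖ : K} (hϖ : Valued.v ϖ = WithZero.exp (-1 : ℤ))
    (hσϖ : σ ϖ = ϖ) (hunit : ∀ u : K, Valued.v u = 1 → σ u = u → ∃ s : K, s * σ s = u) {x : K} (hx : x ≠ 0) (hσx : σ x = x) :
    Literature.NumberTheory.Rogawski1990.Ch3Sec10to13.IsNormFromE F K σ x ↔ Even (WithZero.log (Valued.v x)) :=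
  exists_eq_mul_map_iff_even_log (σ := (σ : K →+* K)) hvσ hϖ hσϖ hunit hx hσx

end NormFromE

/-! ## §2 The unramified quadratic character as a sign, §3 the discharge of L4's `hκ` -/

section Sign

variable {K : Type*} [Field K] [Valued K ℤᵐ⁰] {σ : K →+* K}

open Classical in
/-- **K3 §2 — `ω_{E_w∕F_v}(x) = (ord_w x).negOnePow`**: the quadratic character of the unramified extension, written as the sign
`[x ∈ N(E_w^×)] ? 1 : −1 ∈ ℤˣ`, is `(log v x).negOnePow` for `σ`-fixed `x ≠ 0` (§1 + Mathlib `Int.negOnePow_eq_one_iff` ∕ `_eq_neg_one_iff`).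
[cite: Rogawski1990, §3.12 p. 37; §4.11 p. 64] [cite: Serre1979, Ch. V §2 Cor.] -/
theorem ite_exists_eq_mul_map_eq_negOnePow_log (hvσ : ∀ a, Valued.v (σ a) = Valued.v a) {ϖ : K} (hϖ : Valued.v ϖ = WithZero.exp (-1 : ℤ))
    (hσϖ : σ ϖ = ϖ) (hunit : ∀ u : K, Valued.v u = 1 → σ u = u → ∃ s : K, s * σ s = u) {x : K} (hx : x ≠ 0) (hσx : σ x = x) :
    (if ∃ w : K, w ≠ 0 ∧ x = w * σ w then (1 : ℤˣ) else -1) = (WithZero.log (Valued.v x)).negOnePow := by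
  by_cases h : ∃ w : K, w ≠ 0 ∧ x = w * σ w
  · rw [if_pos h, eq_comm, Int.negOnePow_eq_one_iff]
    exact (exists_eq_mul_map_iff_even_log hvσ hϖ hσϖ hunit hx hσx).1 h
  · rw [if_neg h, eq_comm, Int.negOnePow_eq_neg_one_iff, ← Int.not_even_iff_odd]
    exact fun he => h ((exists_eq_mul_map_iff_even_log hvσ hϖ hσϖ hunit hx hσx).2 he)

open Classical in
/-- **K3 §3 — THE DISCHARGE OF L4's κ-BINDER: `ω(det(d·δ⁻¹)) = (log v det δ − log v det d).negOnePow`** for `d, δ ∈ GL_N(E_w)` with `det(d·δ⁻¹)` `σ`-fixed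
(binder `hfix`, the printed «`det(δ^ν δ⁻¹) ∈ F^×`»), at an inert unramified place (`hvσ`, `hϖ`, `hσϖ`, `hunit`) — token for token the right-hand side of
★ `sum_negOnePow_mul_epsOrbitalIntegral_twistedShell`'s `hκ` (`Theorems/R90S6TwistedKappaOrbitalSign`), so the printed `κ_ν = ω_{E∕F}(det(d_ν δ⁻¹))` feeds L4.
(`det(dδ⁻¹)·det δ = det d`, `WithZero.log_mul`, `Int.negOnePow_neg`.) [cite: Rogawski1990, §3.12 Prop. 3.12.1 (b); §4.11 p. 64] [cite: Kottwitz1986BaseChangeUnits, §1 p. 243] -/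
theorem ite_isNorm_det_eq_negOnePow_log_sub {N : ℕ} (hvσ : ∀ a, Valued.v (σ a) = Valued.v a) {ϖ : K} (hϖ : Valued.v ϖ = WithZero.exp (-1 : ℤ))
    (hσϖ : σ ϖ = ϖ) (hunit : ∀ u : K, Valued.v u = 1 → σ u = u → ∃ s : K, s * σ s = u) (d δ : GL (Fin N) K)
    (hfix : σ (((d * δ⁻¹ : GL (Fin N) K)) : Matrix (Fin N) (Fin N) K).det = (((d * δ⁻¹ : GL (Fin N) K)) : Matrix (Fin N) (Fin N) K).det) :
    (if ∃ w : K, w ≠ 0 ∧ (((d * δ⁻¹ : GL (Fin N) K)) : Matrix (Fin N) (Fin N) K).det = w * σ w then (1 : ℤˣ) else -1) =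
      (WithZero.log (Valued.v ((δ : GL (Fin N) K) : Matrix (Fin N) (Fin N) K).det) -
        WithZero.log (Valued.v ((d : GL (Fin N) K) : Matrix (Fin N) (Fin N) K).det)).negOnePow := by
  have hx0 : (((d * δ⁻¹ : GL (Fin N) K)) : Matrix (Fin N) (Fin N) K).det ≠ 0 := (Matrix.isUnits_det_units _).ne_zero
  have hδ0 : Valued.v ((δ : GL (Fin N) K) : Matrix (Fin N) (Fin N) K).det ≠ 0 :=
    (Valuation.ne_zero_iff _).2 (Matrix.isUnits_det_units _).ne_zero
  have hx0v : Valued.v (((d * δ⁻¹ : GL (Fin N) K)) : Matrix (Fin N) (Fin N) K).det ≠ 0 := (Valuation.ne_zero_iff _).2 hx0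
  -- `det(dδ⁻¹) · det δ = det d`, read through `log ∘ v`
  have hmul : (((d * δ⁻¹ : GL (Fin N) K)) : Matrix (Fin N) (Fin N) K).det * ((δ : GL (Fin N) K) : Matrix (Fin N) (Fin N) K).det =
      ((d : GL (Fin N) K) : Matrix (Fin N) (Fin N) K).det := by
    rw [← Matrix.det_mul, ← Units.val_mul, inv_mul_cancel_right]
  have hlog : WithZero.log (Valued.v (((d * δ⁻¹ : GL (Fin N) K)) : Matrix (Fin N) (Fin N) K).det) =
      WithZero.log (Valued.v ((d : GL (Fin N) K) : Matrix (Fin N) (Fin N) K).det) -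
        WithZero.log (Valued.v ((δ : GL (Fin N) K) : Matrix (Fin N) (Fin N) K).det) := by
    rw [eq_sub_iff_add_eq, ← WithZero.log_mul hx0v hδ0, ← map_mul, hmul]
  rw [ite_exists_eq_mul_map_eq_negOnePow_log hvσ hϖ hσϖ hunit hx0 hfix, hlog, ← neg_sub, Int.negOnePow_neg]

end Sign

/-! ## §4 The CM discharge of `hunit` at an inert unramified place -/

section CM

open NumberField IsDedekindDomain
open Literature.NumberTheory.Automorphic Literature.NumberTheory.Automorphic.UnitaryGroup

/-- **K3 §4 — «FIXED UNITS ARE NORMS» at an inert place `w ∣ v` of the CM extension `L ∕ L⁺` with `v` unramified**: the binder `hunit` of §1–§3 at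
`K = L_w`, `σ = σ_w` (★ `galAdicCompletionMap`), discharged by ★ `K2E5QuatLocalNormSurjective.exists_mul_gal_eq_of_inert` (Serre, *Local Fields* V §2 Cor.).
[cite: Serre1979, Ch. V §2 Prop. 3 Cor.] -/
theorem exists_mul_galAdicCompletionMap_eq_of_valued_eq_one (L : Type) [Field L] [NumberField L] [IsCMField L]
    (v : HeightOneSpectrum (𝓞 ↥(maximalRealSubfield L))) (hv : Algebra.IsUnramifiedIn (𝓞 L) v.asIdeal) (w : PlacesOver L v)
    (hw : IsCMField.complexConj L • w.1 = w.1) :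
    ∀ u : w.1.adicCompletion L, Valued.v u = 1 → galAdicCompletionMap (L := L) (IsCMField.complexConj L) hw u = u →
      ∃ s : w.1.adicCompletion L, s * galAdicCompletionMap (L := L) (IsCMField.complexConj L) hw s = u := by
  intro u hu hσu
  obtain ⟨s, -, hs⟩ := Cruxes.H413.K2E5QuatLocalNormSurjective.exists_mul_gal_eq_of_inert L v hv w hw hu hσu
  exact ⟨s, hs⟩

end CM

end Summit.HodgeConjecture.HodgeConjecture.R90.S6

end
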